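import Literature.Computability.AlgebraicComplexity.LMRDetIdealModuleWeight
import HarnessLib

/-!
# Landsberg–Manivel–Ressayre for `det₃`: discharge of `LMR2013_detThree_idealHwv`

Topic `Computability/AlgebraicComplexity` (geometric complexity theory). One-line consequence of
`LMR2013_thm_1_1_2_1_holds` (`LMRDetIdealModuleWeight.lean`, cell `pub-gct-max`) through
`LMR2013_thm_1_1_2_1.detThree_idealHwv` (`LMRDetIdealModule.lean`; `lmrPartition 3 =
lmrPartitionThree`): the named fact `LMR2013_detThree_idealHwv` of `LMRDetThreeIdealModule.lean`
(cell `pub-gct`, p187078) — "a nonzero highest-weight vector of weight `(19,7,2⁵)^*` of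
`ℂ[Sym³(ℂ^{3×3})]` lies in the ideal of `GL₉·det₃`", LMR 2013 Thm. 1.1.2 (1) with §3.2 at `n = 3`
("the module with highest weight `12ω_1 + 5ω_2 + 2ω_7` … only one copy of it is in the ideal") —
becomes a theorem. Filed in the `pub-gct-max` lineage per the `pub-gct` lead ruling R-LMR
(pub-gct-max/INBOX l.832, 2026-08-23): no file of `pub-gct` is edited; provenance stays
one-directional. Honest framing: a standing-of-hypothesis improvement for `pub-gct`'s
`(19,7,2⁵)@12` det-side comparison theorems; no number of record changes; nothing here is a claim
on VP ≠ VNP or P ≠ NP.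

## References
* [LandsbergManivelRessayre2013] J. M. Landsberg, L. Manivel, N. Ressayre, Comment. Math. Helv. 88
  (2013) 469–484, Thm. 1.1.2 (1) (p. 470), §3.2 (p. 476, `n = 3`).
-/

namespace Literature.Computability.AlgebraicComplexity

/-- **Discharge of `LMR2013_detThree_idealHwv`** (LMR 2013 Thm. 1.1.2 (1) / §3.2 at `n = 3`): the
`n = 3` instance of `LMR2013_thm_1_1_2_1_holds`.
[cite: LandsbergManivelRessayre2013, Thm. 1.1.2 (1) (p. 470) and §3.2 (p. 476), `n = 3`] -/
theorem LMR2013_detThree_idealHwv_holds : LMR2013_detThree_idealHwv :=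
  LMR2013_thm_1_1_2_1_holds.detThree_idealHwv

end Literature.Computability.AlgebraicComplexity
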